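import Literature.Topology.FourManifolds.PropertyRStrict
import Literature.Topology.FourManifolds.PropertyRTraceClosingProofs
import Literature.Topology.FourManifolds.KirbyCalculusUnlinkProofs
import Literature.Topology.FourManifolds.SphereTwoProdCircleSumUniqueness
import Literature.Topology.FourManifolds.DehnSurgeryTransportProofs
import Literature.Topology.FourManifolds.DehnSurgeryUniquenessProofs
import Literature.Topology.FourManifolds.ZeroSurgeryHomotopyBallSliceProofs
import Literature.Topology.FourManifolds.KirbyMovesProofs
import HarnessLib

/-!
# The generalised Property R conjecture for one component is Gabai's Property R

Topic `Literature/Topology/FourManifolds`. The printed generalised Property R conjecture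
(`Literature.Topology.FourManifolds.StrictGeneralizedPropertyRConjecture`, `PropertyRStrict.lean`;
Gompf–Scharlemann–Thompson (2010), §2, Conjecture 1; Kirby (1997), Problem 1.82) asks: if surgery
on an `n`-component framed link `L ⊆ S³` is `#ⁿ (S² × S¹)`, is `L` handle-slide equivalent (strict
2-handle slides, isotopies, renumbering, reversal) to the `0`-framed unlink? Gompf–Scharlemann–
Thompson, §2 (p. 4 of arXiv:1103.1601): *"In the case `n = 1` no slides are possible, so
Conjecture 1 does indeed directly generalize Theorem 1.1"*, and their Theorem 1.1 is **Property R**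
(D. Gabai, *Foliations and the topology of 3-manifolds. III*, J. Differential Geom. 26 (1987),
Cor. 8.3 with Remark 8.5): *"If `0`-framed surgery on a knot `K ⊂ S³` yields `S¹ × S²` then `K`
is the unknot."* This file proves the slice `n = 1` of the printed conjecture from Gabai's
Corollary 8.3 in the tree's form (the named fact
`Literature.Topology.FourManifolds.Knot.hasSeifertSurfaceOfGenus_le_of_isIntegralSurgery_zero` of
`SurgeryGluckPropertyR.lean`, genus clause: a `0`-surgery on `K` containing a nonseparating closed
orientable surface of genus `g` forces a Seifert surface of genus `≤ g`), taken as the ONLY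
hypothesis; everything else is proved in the tree.

## The argument (GST §2 for `n = 1`: Prop. 2.2, then Thm. 1.1)

Let `L = (K, m)` be a one-component framed link and `Y ≅ #¹ (S² × S¹)`
(`IsSphereTwoProdCircleSum 1 Y`) a surgery on `L`, i.e. `Y = S³ₘ(K)`
(`FramedLink.isSurgery_single_iff`).

* `Y` is also `0`-surgery on the unknot
  (`isIntegralSurgery_unknot_zero_of_isSphereTwoProdCircleSum_one`): surgery `Y₀` on the
  `0`-framed unknot exists with `IsSphereTwoProdCircleSum 1 Y₀`
  (`exists_isSurgery_zeroFramedUnlink_holds`), `#¹ (S² × S¹)` has one diffeomorphism type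
  (`IsSphereTwoProdCircleSum.nonempty_diffeomorph`), and surgery presentations move along
  diffeomorphisms (`IsIntegralSurgery.of_diffeomorph_of_boundaryless`). Hence `Y ≅ S² × S¹`
  across models (uniqueness of Dehn surgery, `nonempty_diffeomorph_of_isIntegralSurgery_holds`,
  with `isIntegralSurgery_unknot_zero_holds`), `H₁(Y; ℤ) ≅ ℤ`
  (`IsIntegralSurgery.nonempty_addEquiv_singularHomology_one_int`) and `Y` contains the
  nonseparating sphere `S² × {p}` (`HasNonseparatingSurfaceOfGenus.sphereTwo_prod_sphereOne`,
  `HasNonseparatingSurfaceOfGenus.of_diffeomorph`).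
* Framing (GST Prop. 2.2 at `n = 1`): `H₁(S³ₘ(K)) ≅ ℤ` iff `m = 0`
  (`IsIntegralSurgery.nonempty_addEquiv_singularHomology_one_int_iff`), so `m = 0`.
* Knot (GST Thm. 1.1 = Gabai): Cor. 8.3 applied to the nonseparating sphere gives a Seifert surface
  of genus `≤ 0`, a disc, so `K` is the unknot
  (`Knot.isUnknot_of_hasSeifertSurfaceOfGenus_zero_holds`), i.e. an ambient isotopy `F` with
  `F 1 ∘ K = unknot`.
* Conclusion: `(K, 0)` is isotopic as a framed link to the `0`-framed unknot `(unknot, 0)`, one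
  `StrictHandleSlideMove.isotopy` ("no slides are possible" — none is needed), and `(unknot, 0)` is
  a `0`-framed unlink (spanning disc `unknotDisc`, `isSmoothDisc_unknotDisc_holds`).

## Contents

* `FramedLink.eq_single_of_fin_one`, `FramedLink.exists_eq_single` — a framed link indexed by
  `Fin 1` is `FramedLink.single K m`.
* `FramedLink.isZeroFramedUnlink_single_unknot_zero` — `(unknot, 0)` is a `0`-framed unlink.
* `FramedLink.single_isIsotopic_single` — isotopic knots give isotopic one-component framed links.
* `isIntegralSurgery_unknot_zero_of_isSphereTwoProdCircleSum_one`,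
  `nonempty_diffeomorph_sphereTwo_prod_of_isSphereTwoProdCircleSum_one`,
  `hasNonseparatingSurfaceOfGenus_zero_of_isSphereTwoProdCircleSum_one`,
  `nonempty_addEquiv_singularHomology_one_int_of_isSphereTwoProdCircleSum_one` — `#¹ (S² × S¹)`
  in the model `𝓡 3`: it is `0`-surgery on the unknot, is `≅ S² × S¹`, has a nonseparating sphere
  and `H₁ ≅ ℤ`.
* `IsIntegralSurgery.eq_zero_of_isSphereTwoProdCircleSum_one` — GST Prop. 2.2 at `n = 1`.
* `Knot.isUnknot_of_isIntegralSurgery_zero_of_isSphereTwoProdCircleSum_one` — Property R in the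
  model `𝓡 3`, from Gabai's Cor. 8.3.
* `strictGeneralizedPropertyRConjecture_one_of_gabai` — the slice `n = 1` of the printed
  conjecture; `generalizedPropertyRConjecture_one_of_gabai` — hence of the tree's permissive
  `GeneralizedPropertyRConjecture`.

## References

* D. Gabai, *Foliations and the topology of 3-manifolds. III*, J. Differential Geom. 26 (1987)
  479–536, Cor. 8.3, Remark 8.5. [GabaiJDG1987]
* R. E. Gompf, M. Scharlemann, A. Thompson, *Fibered knots and potential counterexamples to the
  Property 2R and Slice-Ribbon Conjectures*, Geom. Topol. 14 (2010) 2305–2347, §2 (case `n = 1`,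
  Conjecture 1, Prop. 2.2) and Thm. 1.1. [GompfScharlemannThompson2010]
* R. Kirby (ed.), *Problems in low-dimensional topology* (1997), Problem 1.82. [Kirby1997]
* R. E. Gompf, A. I. Stipsicz, *4-Manifolds and Kirby Calculus* (1999), §5.3. [GompfStipsicz1999]

## Design notes

* Universe `0` for `Y`, as in `StrictGeneralizedPropertyRConjecture` and in the homology lemmas of
  `DehnSurgeryHomology.lean`; Gabai's fact is consumed at universe `0` (`.{0}`), as in
  `PropertyRTraceClosingProofs.lean`.
* The instance binders `[SphereEmbedding.SmoothnessFacts] [Knot.TubularNbhd.SmoothnessFacts]` are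
  those of `IsStrictHandleSlideEquivalent`; no isotopy-symmetry fact is needed (the isotopy is
  oriented `K ↦ unknot`, as `Knot.IsUnknot` provides and `StrictHandleSlideMove.isotopy` consumes).
-/

open scoped Manifold ContDiff Topology
open Function Set

noncomputable section

namespace Literature.Topology.FourManifolds

/-! ### One-component framed links -/

namespace FramedLink

/-- A framed link indexed by `Fin 1` is the one-component framed link `(K, m)` of its component
`K = L.component 0` and framing `m = L.framing 0` (the disjointness field is a proposition).
[folklore] -/
theorem eq_single_of_fin_one (L : FramedLink (Fin 1)) :
    L = single (L.component 0) (L.framing 0) := by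
  obtain ⟨⟨c, d⟩, f⟩ := L
  obtain ⟨K, rfl⟩ : ∃ K : Knot, c = fun _ ↦ K :=
    ⟨c 0, funext fun i ↦ congrArg c (Fin.fin_one_eq_zero i)⟩
  obtain ⟨m, rfl⟩ : ∃ m : ℤ, f = fun _ ↦ m :=
    ⟨f 0, funext fun i ↦ congrArg f (Fin.fin_one_eq_zero i)⟩
  rfl

/-- Every one-component framed link is `FramedLink.single K m` for some knot `K` and framing `m`.
[folklore] -/
theorem exists_eq_single (L : FramedLink (Fin 1)) : ∃ (K : Knot) (m : ℤ), L = single K m :=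
  ⟨_, _, L.eq_single_of_fin_one⟩

/-- **The `0`-framed unknot is a `0`-framed unlink**: its one component bounds the standard
smoothly embedded disc `unknotDisc` (`isSmoothDisc_unknotDisc_holds`, `unknotDisc_coe_sphere`),
and there is no second disc to be disjoint from. Gompf–Stipsicz (1999), §5.1. [folklore] -/
theorem isZeroFramedUnlink_single_unknot_zero [SphereEmbedding.SmoothnessFacts] :
    (single unknot 0).IsZeroFramedUnlink :=
  ⟨⟨fun _ ↦ unknotDisc, fun _ ↦ ⟨isSmoothDisc_unknotDisc_holds, unknotDisc_coe_sphere⟩,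
    fun i j hij ↦ absurd (Subsingleton.elim i j) hij⟩, fun _ ↦ rfl⟩

/-- Isotopic knots with the same framing give isotopic one-component framed links (the same
ambient isotopy, and equal framing functions). [folklore] -/
theorem single_isIsotopic_single {K K' : Knot} (h : K.IsIsotopic K') (m : ℤ) :
    (single K m).IsIsotopic (single K' m) := by
  obtain ⟨F, hF⟩ := h
  exact ⟨⟨F, fun _ ↦ hF⟩, rfl⟩

end FramedLink

/-! ### `#¹ (S² × S¹)` in the model `𝓡 3` -/

section SphereTwoProdCircle

variable [SphereEmbedding.SmoothnessFacts] (Y : Type) [TopologicalSpace Y] [T2Space Y]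
  [ChartedSpace (EuclideanSpace ℝ (Fin 3)) Y] [IsManifold (𝓡 3) ∞ Y]

/-- **A `3`-manifold which is `#¹ (S² × S¹)` is `0`-surgery on the unknot** (model `𝓡 3`):
surgery `Y₀` on the `0`-framed unknot exists with `IsSphereTwoProdCircleSum 1 Y₀`
(`exists_isSurgery_zeroFramedUnlink_holds`, Gompf–Stipsicz §5.3), `Y ≅ Y₀` since
`IsSphereTwoProdCircleSum 1` has one diffeomorphism type
(`IsSphereTwoProdCircleSum.nonempty_diffeomorph`), and the surgery presentation of `Y₀` is
transported to `Y` (`IsIntegralSurgery.of_diffeomorph_of_boundaryless`). Rolfsen (1976), §9.G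
Example 3; Gompf–Stipsicz (1999), §5.3. [cite: GompfStipsicz1999, §5.3] -/
theorem isIntegralSurgery_unknot_zero_of_isSphereTwoProdCircleSum_one
    (hY : IsSphereTwoProdCircleSum 1 Y) : IsIntegralSurgery (𝓡 3) Y unknot 0 := by
  obtain ⟨Y₀, _, _, _, _, _, _, _, hY₀, hU₀⟩ :=
    exists_isSurgery_zeroFramedUnlink_holds (FramedLink.single unknot 0)
      FramedLink.isZeroFramedUnlink_single_unknot_zero
  obtain ⟨e⟩ := IsSphereTwoProdCircleSum.nonempty_diffeomorph 1 Y₀ Y hY₀ hY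
  exact ((FramedLink.isSurgery_single_iff unknot 0).1 hU₀).of_diffeomorph_of_boundaryless e

/-- **A `3`-manifold which is `#¹ (S² × S¹)` is diffeomorphic to Mathlib's product `S² × S¹`**
(models `𝓡 3` and `(𝓡 2).prod (𝓡 1)`): both are `0`-surgery on the unknot
(`isIntegralSurgery_unknot_zero_of_isSphereTwoProdCircleSum_one`,
`isIntegralSurgery_unknot_zero_holds`), and Dehn surgery is unique across models
(`nonempty_diffeomorph_of_isIntegralSurgery_holds`). Gompf–Stipsicz (1999), §5.3.
[cite: GompfStipsicz1999, §5.3] -/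
theorem nonempty_diffeomorph_sphereTwo_prod_of_isSphereTwoProdCircleSum_one
    (hY : IsSphereTwoProdCircleSum 1 Y) :
    Nonempty (Y ≃ₘ⟮𝓡 3, (𝓡 2).prod (𝓡 1)⟯
      (Metric.sphere (0 : EuclideanSpace ℝ (Fin 3)) 1 ×
        Metric.sphere (0 : EuclideanSpace ℝ (Fin 2)) 1)) :=
  nonempty_diffeomorph_of_isIntegralSurgery_holds (SphereEmbedding.IsIsotopic.refl unknot)
    (isIntegralSurgery_unknot_zero_of_isSphereTwoProdCircleSum_one Y hY)
    isIntegralSurgery_unknot_zero_holds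

/-- **`#¹ (S² × S¹)` contains a nonseparating sphere**: transport `S² × {p} ⊆ S² × S¹`
(`HasNonseparatingSurfaceOfGenus.sphereTwo_prod_sphereOne`, Gabai (1987), Remark 8.5) along the
diffeomorphism `Y ≅ S² × S¹` (`HasNonseparatingSurfaceOfGenus.of_diffeomorph`). [folklore] -/
theorem hasNonseparatingSurfaceOfGenus_zero_of_isSphereTwoProdCircleSum_one
    (hY : IsSphereTwoProdCircleSum 1 Y) : HasNonseparatingSurfaceOfGenus (𝓡 3) Y 0 := by
  obtain ⟨θ⟩ := nonempty_diffeomorph_sphereTwo_prod_of_isSphereTwoProdCircleSum_one Y hY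
  exact (HasNonseparatingSurfaceOfGenus.sphereTwo_prod_sphereOne (circlePoint 0)).of_diffeomorph
    θ.symm

/-- **`H₁(#¹ (S² × S¹); ℤ) ≅ ℤ`**, read off the presentation of `Y` as `0`-surgery on the unknot
(`IsIntegralSurgery.nonempty_addEquiv_singularHomology_one_int`, Gabai (1987), Def. 8.1).
[folklore] -/
theorem nonempty_addEquiv_singularHomology_one_int_of_isSphereTwoProdCircleSum_one
    (hY : IsSphereTwoProdCircleSum 1 Y) :
    Nonempty (Literature.AlgebraicTopology.SingularHomology.singularHomology ℤ ℤ Y 1 ≃+ ℤ) :=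
  (isIntegralSurgery_unknot_zero_of_isSphereTwoProdCircleSum_one Y
    hY).nonempty_addEquiv_singularHomology_one_int

variable {Y}

/-- **The framing of a one-component R-link is `0`** (Gompf–Scharlemann–Thompson (2010),
Prop. 2.2 at `n = 1`; Gabai (1987), Def. 8.1): if `m`-surgery on `K` is `#¹ (S² × S¹)` then
`m = 0`, since `H₁(S³ₘ(K); ℤ) ≅ ℤ` iff `m = 0`
(`IsIntegralSurgery.nonempty_addEquiv_singularHomology_one_int_iff`).
[cite: GompfScharlemannThompson2010, Prop. 2.2 (n = 1)] -/
theorem IsIntegralSurgery.eq_zero_of_isSphereTwoProdCircleSum_one {K : Knot} {m : ℤ}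
    (hK : IsIntegralSurgery (𝓡 3) Y K m) (hY : IsSphereTwoProdCircleSum 1 Y) : m = 0 :=
  hK.nonempty_addEquiv_singularHomology_one_int_iff.1
    (nonempty_addEquiv_singularHomology_one_int_of_isSphereTwoProdCircleSum_one Y hY)

/-- **Property R in the model `𝓡 3`, from Gabai's Corollary 8.3**: if `0`-surgery on `K` is
`#¹ (S² × S¹)`, then `K` is the unknot — Cor. 8.3 (genus clause,
`Knot.hasSeifertSurfaceOfGenus_le_of_isIntegralSurgery_zero`, the hypothesis `h83`) applied to the
nonseparating sphere of `Y` gives a Seifert surface of genus `≤ 0`, a disc, and a knot bounding a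
disc is trivial (`Knot.isUnknot_of_hasSeifertSurfaceOfGenus_zero_holds`). Gabai (1987), Cor. 8.3
and Remark 8.5; Gompf–Scharlemann–Thompson (2010), Thm. 1.1.
[cite: GabaiJDG1987, Cor. 8.3 and Remark 8.5] -/
theorem Knot.isUnknot_of_isIntegralSurgery_zero_of_isSphereTwoProdCircleSum_one
    (h83 : Knot.hasSeifertSurfaceOfGenus_le_of_isIntegralSurgery_zero.{0}) {K : Knot}
    (hK : IsIntegralSurgery (𝓡 3) Y K 0) (hY : IsSphereTwoProdCircleSum 1 Y) : K.IsUnknot := by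
  obtain ⟨g', hg', hKg⟩ := h83 K (𝓡 3) Y hK 0
    (hasNonseparatingSurfaceOfGenus_zero_of_isSphereTwoProdCircleSum_one Y hY)
  obtain rfl : g' = 0 := Nat.le_zero.mp hg'
  exact Knot.isUnknot_of_hasSeifertSurfaceOfGenus_zero_holds K hKg

end SphereTwoProdCircle

/-! ### The slice `n = 1` of the printed generalised Property R conjecture -/

/-- **Generalised Property R for one component (= Property R), from Gabai's Corollary 8.3.**
The slice `n = 1` of the printed conjecture `StrictGeneralizedPropertyRConjecture`
(Gompf–Scharlemann–Thompson (2010), §2, Conjecture 1; Kirby (1997), Problem 1.82): if surgery on a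
one-component framed link `L = (K, m)` is `#¹ (S² × S¹)`, then `L` is strictly handle-slide
equivalent to a `0`-framed unlink — GIVEN Gabai's Cor. 8.3 in the tree's form
(`Knot.hasSeifertSurfaceOfGenus_le_of_isIntegralSurgery_zero`, hypothesis `h83`). Proof
(Gompf–Scharlemann–Thompson, §2: *"In the case `n = 1` no slides are possible, so Conjecture 1 does
indeed directly generalize Theorem 1.1"*): `Y = S³ₘ(K)` (`FramedLink.isSurgery_single_iff`) with
`m = 0` (Prop. 2.2, `IsIntegralSurgery.eq_zero_of_isSphereTwoProdCircleSum_one`) and `K` the unknot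
(Thm. 1.1 = Gabai, `Knot.isUnknot_of_isIntegralSurgery_zero_of_isSphereTwoProdCircleSum_one`), so
`(K, 0)` is isotopic to the `0`-framed unknot (one `StrictHandleSlideMove.isotopy`), which is a
`0`-framed unlink (`FramedLink.isZeroFramedUnlink_single_unknot_zero`).
[cite: GompfScharlemannThompson2010, §2 (case n = 1) and Thm. 1.1]
[cite: GabaiJDG1987, Cor. 8.3 and Remark 8.5] -/
theorem strictGeneralizedPropertyRConjecture_one_of_gabai
    [SphereEmbedding.SmoothnessFacts] [Knot.TubularNbhd.SmoothnessFacts]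
    (h83 : Knot.hasSeifertSurfaceOfGenus_le_of_isIntegralSurgery_zero.{0})
    (L : FramedLink (Fin 1)) (Y : Type) [TopologicalSpace Y] [T2Space Y]
    [SecondCountableTopology Y] [ChartedSpace (EuclideanSpace ℝ (Fin 3)) Y]
    [IsManifold (𝓡 3) ∞ Y] [CompactSpace Y] [ConnectedSpace Y]
    (hY : IsSphereTwoProdCircleSum 1 Y) (hL : L.IsSurgery (𝓡 3) Y) :
    ∃ U : FramedLink (Fin 1),
      U.IsZeroFramedUnlink ∧ IsStrictHandleSlideEquivalent ⟨1, L⟩ ⟨1, U⟩ := by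
  obtain ⟨K, m, rfl⟩ := L.exists_eq_single
  have hK : IsIntegralSurgery (𝓡 3) Y K m := (FramedLink.isSurgery_single_iff K m).1 hL
  obtain rfl : m = 0 := hK.eq_zero_of_isSphereTwoProdCircleSum_one hY
  have hKU : K.IsUnknot :=
    Knot.isUnknot_of_isIntegralSurgery_zero_of_isSphereTwoProdCircleSum_one h83 hK hY
  exact ⟨FramedLink.single unknot 0, FramedLink.isZeroFramedUnlink_single_unknot_zero,
    (StrictHandleSlideMove.isotopy
      (FramedLink.single_isIsotopic_single hKU 0)).isStrictHandleSlideEquivalent⟩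

/-- Hence the slice `n = 1` of the tree's (permissive, formally weaker) statement
`GeneralizedPropertyRConjecture` (`KirbyCalculus.lean`), from Gabai's Corollary 8.3: strict
handle-slide equivalence refines `IsHandleSlideEquivalent`
(`IsStrictHandleSlideEquivalent.isHandleSlideEquivalent`).
[cite: GompfScharlemannThompson2010, §2 (case n = 1) and Thm. 1.1] -/
theorem generalizedPropertyRConjecture_one_of_gabai
    [SphereEmbedding.SmoothnessFacts] [Knot.TubularNbhd.SmoothnessFacts]
    (h83 : Knot.hasSeifertSurfaceOfGenus_le_of_isIntegralSurgery_zero.{0})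
    (L : FramedLink (Fin 1)) (Y : Type) [TopologicalSpace Y] [T2Space Y]
    [SecondCountableTopology Y] [ChartedSpace (EuclideanSpace ℝ (Fin 3)) Y]
    [IsManifold (𝓡 3) ∞ Y] [CompactSpace Y] [ConnectedSpace Y]
    (hY : IsSphereTwoProdCircleSum 1 Y) (hL : L.IsSurgery (𝓡 3) Y) :
    ∃ U : FramedLink (Fin 1), U.IsZeroFramedUnlink ∧ IsHandleSlideEquivalent ⟨1, L⟩ ⟨1, U⟩ := by
  obtain ⟨U, hU, hLU⟩ := strictGeneralizedPropertyRConjecture_one_of_gabai h83 L Y hY hL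
  exact ⟨U, hU, hLU.isHandleSlideEquivalent⟩

end Literature.Topology.FourManifolds

end
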